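/-
Copyright (c) 2026 the pub-hodgecm-mathlib formalisation cell (harness21).  Prover seat hodgecm-mathlib-K2E4-p07 (g3), Track B «K2-LIT» ∕ h413
(stmt-HodgeConjecture-24833), unit «WeakMatrixRigidity», socket #22S `sig_K2E4WeakMatrixFiniteTransportSplit`: the FULL-FRAME ASSEMBLY over the JOINT letter
(GS+RK2)_v′ «central germ structure + rank two among EXPLICIT transfer pairs at a split place» (K2E4-p01 (g3) RE-CUT 01:08:13Z of F-B).  2026-09-04.
-/
import Summits.HodgeConjecture.HodgeConjecture.Theorems.K2E4WeakMatrixFiniteTransportSplitOfGermStructure   -- ★ p855355 (K2E4-p18 (g2)): split bookkeeping lemmas `delta_eq_zero_of_ne_mk_of_split`, `isLocalNormPair_out_mk`; transitively ★ p855314 `weakMatrixFiniteTransport_of_germStructure`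
import Summits.HodgeConjecture.HodgeConjecture.Theorems.K2E3GermConstantRegularHRSplit                      -- ★ p854983 (K2E4-p07 (g0)): the frame imports + split-place plumbing idiom (Haar-of-νH, `w ∣ v`)
import Literature.NumberTheory.Rogawski1990.SmoothTransferSplitPlace                                         -- ★ `isLocalDeltaTransferExists_finExplicit_of_split` (N6 split clause, Prop. 4.9.1 (a))
import Literature.NumberTheory.Rogawski1990.LocalTransferSplitPlaceClasses                                   -- ★ `exists_isLocalNormPair_of_split` (one matching class at a split place)
import Literature.NumberTheory.Rogawski1990.FinExplicitTransferFactorNondegenerate                           -- ★ `isLocalNondegenerate_finExplicitCollection`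
import Literature.NumberTheory.Weil1982.UnitaryFinCentralizerTopFormHaar                                     -- ★ `UnitaryFinTopForm.finTamagawaPartner` (the socket's |ω|_v-family binder)
import Literature.NumberTheory.Rogawski1990.ExplicitFactorProductFormula                                     -- ★ `finExplicitCollection`, `UnitaryGroup.PlacesOver`
import HarnessLib

/-!
# K2_E4 road (h413 = stmt-HodgeConjecture-24833), unit «WeakMatrixRigidity», socket #22S — the full-frame assembly `‹(GS+RK2)_v′› → ‹sig_K2E4WeakMatrixFiniteTransportSplit›`

Cell `pub/hodgecm-mathlib` (D-0151), Track B «K2-LIT» (21-frontier RULING «PUSH BOTH» 2026-09-03); socket module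
`Summits/HodgeConjecture/HodgeConjecture/Cruxes/H413/Lines/K2_E4_SingularTransferKappaSignSigsWeakMatrixRigidity.lean` (ED. 3, :447), socket #22S
`sig_K2E4WeakMatrixFiniteTransportSplit` (after #1′ ★ p855986 the tier-0 stub C waits on #22S ALONE via ★ `Compositions.stubC_of_sigsSplit`).

WHY THIS ROAD (K2E4-p01 (g3) REPORT-FIRST 01:08:13Z on F-B, read «=»).  The previous road (★ ED. R p856157 ∕ ★ p856290: #22S ⟸ (LIFT_v)) needs the letter (LIFT_v)
«every germ of `M`-orbital-integral functions near `z_v` is the constant term of some `f`» = the orbital-integral ASCENT at a `(G′, M)`-regular point (Harish-Chandra's open chart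
`G′ ×_M V ≅ G′·V`) — TRUE but XL with no tree support (the tree has only the DESCENT ★ B5-R).  What ★ p855314 `weakMatrixFiniteTransport_of_germStructure` actually reads is weaker:
RANK TWO AMONG EXPLICIT PAIRS (`hRK`: two smooth `Δ‴_v`-transfer pairs `(fH′ᵢ, fᵢ)` whose `H`-side germ pairs `(a′ᵢ, b′ᵢ)` on the ray are independent).  The JOINT letter
(GS+RK2)_v′ packages, over ONE ray `γ_n → z_v` and one germ sequence `G`: the (GS_v′) clauses (two-term germ structure of `Φ^st_H` with the central value read off, `H`-side rank two)
AND `hRK` verbatim.  K2E4-p01 (g3) pays it (`K2E3CentralGermStructureRankTwoSplit`: files (P⁺) (T⁺) (R) over his ★ GL₂ × GL₁ ray engine p856186∕p856232∕p856267 + F-C2 ★ p856204 §1);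
THIS FILE is the consumer: the socket from the letter, in the socket's own frame.

ED. R of ★ p856383 (same proof, ONE binder byte of the HYPOTHESIS repaired): p856383's letter binder read `[IsFiniteMeasureOnCompacts νHv]` (inherited from the
(LIFT_v) prefix cand :83) although its docstring and the dealt letter (K2E4-r02's one-token fix, the bytes ★ p856525 `K2E4SplitTransferRankTwo.centralGermStructureRankTwo_split`
proves) say `[νHv.IsHaarMeasure]`; with the weaker class the ∀-closed hypothesis is unsatisfiable (νHv = 0 kills `lam ≠ 0`, cf. the (GS_v) finding) and p856383 is
archival.  THIS file states the hypothesis with `[νHv.IsHaarMeasure]` — literally ★ p856525's type — so the BY-NAME closer is `weakMatrixFiniteTransportSplit_of_rankTwoR … centralGermStructureRankTwo_split`.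

THE THEOREM.  **`weakMatrixFiniteTransportSplit_of_rankTwoR (hGSRK : ‹(GS+RK2)_v′›) : ‹sig_K2E4WeakMatrixFiniteTransportSplit›`** — the socket's statement VERBATIM (frame binders
byte-for-byte from the socket module); the hypothesis is the ∀-closed joint letter whose prefix is (LIFT_v)'s (cand :83 of 7dbffbb82dc76fe3: `L H′ hherm hanis v ¬Subsingleton`,
σ-algebras, `νHv νGv` with `[νHv.IsHaarMeasure]` (the (GS_v′) repair), canonical `mHv mGv`, `μ hμu hμω`, `γ_H = (e₁·1₂, e₂)`), and whose conclusion is `∃ γ G λ λ′,` (GS_v′)'s six clauses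
`∧` ★ p855314's `hRK` clause TOKEN FOR TOKEN.

THE PROOF (plumbing only).  Split witness `w ∣ v`; `νH v` Haar (★ p854983 idiom); `IsLocalTransferDatum` and the two `IsCanonical` clauses off `hCTM.1 v`; `Δ‴_v`-transfer existence ★
`isLocalDeltaTransferExists_finExplicit_of_split`; the letter at `(νH v, νG v, mH v, mG v)`; ONE matching class along the ray and non-vanishing of both factors there EXACTLY as in
★ p855355 (`exists_isLocalNormPair_of_split`, `delta_eq_zero_of_ne_mk_of_split`, `isLocalNormPair_out_mk`, `IsLocalNondegenerate` of the weak factor from `hCTM`, ★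
`isLocalNondegenerate_finExplicitCollection`); conclude by ★ p855314 `weakMatrixFiniteTransport_of_germStructure` (Möbius central-value rigidity) fed `hGS` and `hRK` from the letter.
The letter's `Tendsto`, `λ ≠ 0` and `H`-side rank-two clauses are carried, not read.

* **`weakMatrixFiniteTransportSplit_of_rankTwo`** — as above.  BY-NAME payer of #22S once (GS+RK2)_v′ is ★ `gsrk`: the one-liner `weakMatrixFiniteTransportSplit_of_rankTwo … gsrk`.

HONEST LABEL: HC_CM is proved only modulo the 7 printed citations (2 remaining named inputs: hLiu418 = stmt-HodgeConjecture-24832, h413 =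
stmt-HodgeConjecture-24833) until rung 0 closes; this file is a `--supports stmt-HodgeConjecture-24833` helper: it pays #22S MODULO (GS+RK2)_v′ and proves no printed analytic
statement; the crux item stays OPEN.

## References
* [Rogawski1990] J. D. Rogawski, *Automorphic Representations of Unitary Groups in Three Variables*, Ann. of Math. Stud. 123 (1990): §4.9 Prop. 4.9.1 (a) p. 55;
  §4.13 Lemma 4.13.1 (a) p. 64; §8.1 Props. 8.1.1–8.1.3, (8.1.1)–(8.1.2) pp. 112–117; §8.2 Prop. 8.2.1 (a) p. 117; §14.2 p. 232.
* [HarishChandra1999AdmissibleDistributions] Harish-Chandra (DeBacker–Sally), *Admissible Invariant Distributions on Reductive p-adic Groups*, AMS ULS 16 (1999), Thm. 3.1.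
* [LabesseLanglands1979] J.-P. Labesse, R. P. Langlands, *L-indistinguishability for SL(2)*, Canad. J. Math. 31 (1979), §2.
-/

set_option autoImplicit false
set_option linter.dupNamespace false

noncomputable section

open MeasureTheory Measure NumberField IsDedekindDomain Filter
open Literature.MeasureTheory.Group Literature.MeasureTheory.RestrictedProduct
open Literature.Topology.RestrictedProduct Literature.Topology.Algebra.RestrictedProduct
open Literature.NumberTheory.Rogawski1990 Literature.NumberTheory.Automorphic Literature.NumberTheory.GaloisRepresentations
open Literature.AlgebraicGeometry.ShimuraVarieties (unitaryGroup hermForm)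
open Summit.HodgeConjecture.HodgeConjecture.Cruxes.H413.K2E4WeakMatrixFiniteTransportOfGermRigidity (weakMatrixFiniteTransport_of_germStructure)
open Summit.HodgeConjecture.HodgeConjecture.Cruxes.H413.K2E4WeakMatrixFiniteTransportSplitOfGermStructure (delta_eq_zero_of_ne_mk_of_split isLocalNormPair_out_mk)
open scoped Matrix MatrixGroups RestrictedProduct

namespace Summit.HodgeConjecture.HodgeConjecture.Cruxes.H413.K2E4WeakMatrixFiniteTransportSplitOfRankTwoR

section Frame

variable (L : Type) [Field L] [NumberField L] [IsCMField L]

variable (H' : Matrix (Fin 3) (Fin 3) L) (Tinf : ArchTransferFactor L H')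
    -- σ-algebras of the `G′` side (★ (O10-c5) block), of `H_v`, `G_∞`, `H_∞`, and the Haar data — EXACTLY ★ `SingularEllipticTransfer`'s binders
    [∀ g : (UnitaryGroup.cmDatum L 3 H').Adelic, MeasurableSpace ((UnitaryGroup.cmDatum L 3 H').Adelic ⧸ Subgroup.centralizer ({g} : Set (UnitaryGroup.cmDatum L 3 H').Adelic))]
    [∀ g : (UnitaryGroup.cmDatum L 3 H').Adelic, BorelSpace ((UnitaryGroup.cmDatum L 3 H').Adelic ⧸ Subgroup.centralizer ({g} : Set (UnitaryGroup.cmDatum L 3 H').Adelic))]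
    [∀ γ : UnitaryGroup.arch (↥(maximalRealSubfield L)) L (IsCMField.complexConj L) 3 H',
      MeasurableSpace (UnitaryGroup.arch (↥(maximalRealSubfield L)) L (IsCMField.complexConj L) 3 H' ⧸ Subgroup.centralizer ({γ} : Set (UnitaryGroup.arch (↥(maximalRealSubfield L)) L (IsCMField.complexConj L) 3 H')))]
    [∀ γ : UnitaryGroup.arch (↥(maximalRealSubfield L)) L (IsCMField.complexConj L) 3 H',
      BorelSpace (UnitaryGroup.arch (↥(maximalRealSubfield L)) L (IsCMField.complexConj L) 3 H' ⧸ Subgroup.centralizer ({γ} : Set (UnitaryGroup.arch (↥(maximalRealSubfield L)) L (IsCMField.complexConj L) 3 H')))]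
    [∀ (v : HeightOneSpectrum (𝓞 ↥(maximalRealSubfield L))) (γ : (UnitaryGroup.cmDatum L 3 H').Local v),
      MeasurableSpace ((UnitaryGroup.cmDatum L 3 H').Local v ⧸ Subgroup.centralizer ({γ} : Set ((UnitaryGroup.cmDatum L 3 H').Local v)))]
    [∀ (v : HeightOneSpectrum (𝓞 ↥(maximalRealSubfield L))) (γ : (UnitaryGroup.cmDatum L 3 H').Local v),
      BorelSpace ((UnitaryGroup.cmDatum L 3 H').Local v ⧸ Subgroup.centralizer ({γ} : Set ((UnitaryGroup.cmDatum L 3 H').Local v)))]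
    [∀ v : HeightOneSpectrum (𝓞 ↥(maximalRealSubfield L)), MeasurableSpace ((UnitaryGroup.cmDatum L 3 H').Local v)] [∀ v : HeightOneSpectrum (𝓞 ↥(maximalRealSubfield L)), BorelSpace ((UnitaryGroup.cmDatum L 3 H').Local v)]
    [MeasurableSpace (UnitaryGroup.cmDatum L 3 H').Adelic] [BorelSpace (UnitaryGroup.cmDatum L 3 H').Adelic]
    [MeasurableSpace (UnitaryGroup.arch (↥(maximalRealSubfield L)) L (IsCMField.complexConj L) 3 H')] [BorelSpace (UnitaryGroup.arch (↥(maximalRealSubfield L)) L (IsCMField.complexConj L) 3 H')]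
    [∀ γ : (UnitaryGroup.cmDatum L 3 H').Adelic, MeasurableSpace (↥(Subgroup.centralizer ({γ} : Set (UnitaryGroup.cmDatum L 3 H').Adelic)) ⧸
      ((UnitaryGroup.cmDatum L 3 H').quotientSubgroup ⊓ Subgroup.centralizer ({γ} : Set (UnitaryGroup.cmDatum L 3 H').Adelic)).subgroupOf (Subgroup.centralizer ({γ} : Set (UnitaryGroup.cmDatum L 3 H').Adelic)))]
    [∀ γ : (UnitaryGroup.cmDatum L 3 H').Adelic, BorelSpace (↥(Subgroup.centralizer ({γ} : Set (UnitaryGroup.cmDatum L 3 H').Adelic)) ⧸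
      ((UnitaryGroup.cmDatum L 3 H').quotientSubgroup ⊓ Subgroup.centralizer ({γ} : Set (UnitaryGroup.cmDatum L 3 H').Adelic)).subgroupOf (Subgroup.centralizer ({γ} : Set (UnitaryGroup.cmDatum L 3 H').Adelic)))]
    [hCcl : ∀ γ : (UnitaryGroup.cmDatum L 3 H').Adelic, IsClosed ((Subgroup.centralizer ({γ} : Set (UnitaryGroup.cmDatum L 3 H').Adelic) : Subgroup (UnitaryGroup.cmDatum L 3 H').Adelic) : Set (UnitaryGroup.cmDatum L 3 H').Adelic)]
    [∀ γ : (UnitaryGroup.cmDatum L 3 H').Adelic, (count : Measure ↥(((UnitaryGroup.cmDatum L 3 H').quotientSubgroup ⊓ Subgroup.centralizer ({γ} : Set (UnitaryGroup.cmDatum L 3 H').Adelic)).subgroupOf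
      (Subgroup.centralizer ({γ} : Set (UnitaryGroup.cmDatum L 3 H').Adelic)))).IsHaarMeasure]
    [∀ v : HeightOneSpectrum (𝓞 ↥(maximalRealSubfield L)), MeasurableSpace ((UnitaryGroup.cmDatum L 2 (Matrix.of fun i j : Fin 2 => if i.val + j.val + 1 = 2 then (1 : L) else 0)).Local v ×
        (UnitaryGroup.cmDatum L 1 (Matrix.of fun i j : Fin 1 => if i.val + j.val + 1 = 1 then (1 : L) else 0)).Local v)]
    [∀ v : HeightOneSpectrum (𝓞 ↥(maximalRealSubfield L)), BorelSpace ((UnitaryGroup.cmDatum L 2 (Matrix.of fun i j : Fin 2 => if i.val + j.val + 1 = 2 then (1 : L) else 0)).Local v ×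
        (UnitaryGroup.cmDatum L 1 (Matrix.of fun i j : Fin 1 => if i.val + j.val + 1 = 1 then (1 : L) else 0)).Local v)]
    [∀ (v : HeightOneSpectrum (𝓞 ↥(maximalRealSubfield L))) (a : ((UnitaryGroup.cmDatum L 2 (Matrix.of fun i j : Fin 2 => if i.val + j.val + 1 = 2 then (1 : L) else 0)).Local v ×
        (UnitaryGroup.cmDatum L 1 (Matrix.of fun i j : Fin 1 => if i.val + j.val + 1 = 1 then (1 : L) else 0)).Local v)),
      MeasurableSpace (((UnitaryGroup.cmDatum L 2 (Matrix.of fun i j : Fin 2 => if i.val + j.val + 1 = 2 then (1 : L) else 0)).Local v ×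
        (UnitaryGroup.cmDatum L 1 (Matrix.of fun i j : Fin 1 => if i.val + j.val + 1 = 1 then (1 : L) else 0)).Local v) ⧸ Subgroup.centralizer ({a} : Set ((UnitaryGroup.cmDatum L 2 (Matrix.of fun i j : Fin 2 => if i.val + j.val + 1 = 2 then (1 : L) else 0)).Local v ×
        (UnitaryGroup.cmDatum L 1 (Matrix.of fun i j : Fin 1 => if i.val + j.val + 1 = 1 then (1 : L) else 0)).Local v)))]
    [∀ (v : HeightOneSpectrum (𝓞 ↥(maximalRealSubfield L))) (a : ((UnitaryGroup.cmDatum L 2 (Matrix.of fun i j : Fin 2 => if i.val + j.val + 1 = 2 then (1 : L) else 0)).Local v ×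
        (UnitaryGroup.cmDatum L 1 (Matrix.of fun i j : Fin 1 => if i.val + j.val + 1 = 1 then (1 : L) else 0)).Local v)),
      BorelSpace (((UnitaryGroup.cmDatum L 2 (Matrix.of fun i j : Fin 2 => if i.val + j.val + 1 = 2 then (1 : L) else 0)).Local v ×
        (UnitaryGroup.cmDatum L 1 (Matrix.of fun i j : Fin 1 => if i.val + j.val + 1 = 1 then (1 : L) else 0)).Local v) ⧸ Subgroup.centralizer ({a} : Set ((UnitaryGroup.cmDatum L 2 (Matrix.of fun i j : Fin 2 => if i.val + j.val + 1 = 2 then (1 : L) else 0)).Local v ×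
        (UnitaryGroup.cmDatum L 1 (Matrix.of fun i j : Fin 1 => if i.val + j.val + 1 = 1 then (1 : L) else 0)).Local v)))]
    [MeasurableSpace (UnitaryGroup.arch (↥(maximalRealSubfield L)) L (IsCMField.complexConj L) 3 (Matrix.of fun i j : Fin 3 => if i.val + j.val + 1 = 3 then (1 : L) else 0))] [BorelSpace (UnitaryGroup.arch (↥(maximalRealSubfield L)) L (IsCMField.complexConj L) 3 (Matrix.of fun i j : Fin 3 => if i.val + j.val + 1 = 3 then (1 : L) else 0))]
    [∀ γ : UnitaryGroup.arch (↥(maximalRealSubfield L)) L (IsCMField.complexConj L) 3 (Matrix.of fun i j : Fin 3 => if i.val + j.val + 1 = 3 then (1 : L) else 0),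
      MeasurableSpace (UnitaryGroup.arch (↥(maximalRealSubfield L)) L (IsCMField.complexConj L) 3 (Matrix.of fun i j : Fin 3 => if i.val + j.val + 1 = 3 then (1 : L) else 0) ⧸ Subgroup.centralizer ({γ} : Set (UnitaryGroup.arch (↥(maximalRealSubfield L)) L (IsCMField.complexConj L) 3 (Matrix.of fun i j : Fin 3 => if i.val + j.val + 1 = 3 then (1 : L) else 0))))]
    [∀ γ : UnitaryGroup.arch (↥(maximalRealSubfield L)) L (IsCMField.complexConj L) 3 (Matrix.of fun i j : Fin 3 => if i.val + j.val + 1 = 3 then (1 : L) else 0),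
      BorelSpace (UnitaryGroup.arch (↥(maximalRealSubfield L)) L (IsCMField.complexConj L) 3 (Matrix.of fun i j : Fin 3 => if i.val + j.val + 1 = 3 then (1 : L) else 0) ⧸ Subgroup.centralizer ({γ} : Set (UnitaryGroup.arch (↥(maximalRealSubfield L)) L (IsCMField.complexConj L) 3 (Matrix.of fun i j : Fin 3 => if i.val + j.val + 1 = 3 then (1 : L) else 0))))]
    [MeasurableSpace (UnitaryGroup.arch (↥(maximalRealSubfield L)) L (IsCMField.complexConj L) 2 (Matrix.of fun i j : Fin 2 => if i.val + j.val + 1 = 2 then (1 : L) else 0) ×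
          UnitaryGroup.arch (↥(maximalRealSubfield L)) L (IsCMField.complexConj L) 1 (Matrix.of fun i j : Fin 1 => if i.val + j.val + 1 = 1 then (1 : L) else 0))]
    [BorelSpace (UnitaryGroup.arch (↥(maximalRealSubfield L)) L (IsCMField.complexConj L) 2 (Matrix.of fun i j : Fin 2 => if i.val + j.val + 1 = 2 then (1 : L) else 0) ×
          UnitaryGroup.arch (↥(maximalRealSubfield L)) L (IsCMField.complexConj L) 1 (Matrix.of fun i j : Fin 1 => if i.val + j.val + 1 = 1 then (1 : L) else 0))]
    [∀ a : (UnitaryGroup.arch (↥(maximalRealSubfield L)) L (IsCMField.complexConj L) 2 (Matrix.of fun i j : Fin 2 => if i.val + j.val + 1 = 2 then (1 : L) else 0) ×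
          UnitaryGroup.arch (↥(maximalRealSubfield L)) L (IsCMField.complexConj L) 1 (Matrix.of fun i j : Fin 1 => if i.val + j.val + 1 = 1 then (1 : L) else 0)),
      MeasurableSpace ((UnitaryGroup.arch (↥(maximalRealSubfield L)) L (IsCMField.complexConj L) 2 (Matrix.of fun i j : Fin 2 => if i.val + j.val + 1 = 2 then (1 : L) else 0) ×
          UnitaryGroup.arch (↥(maximalRealSubfield L)) L (IsCMField.complexConj L) 1 (Matrix.of fun i j : Fin 1 => if i.val + j.val + 1 = 1 then (1 : L) else 0)) ⧸ Subgroup.centralizer ({a} : Set (UnitaryGroup.arch (↥(maximalRealSubfield L)) L (IsCMField.complexConj L) 2 (Matrix.of fun i j : Fin 2 => if i.val + j.val + 1 = 2 then (1 : L) else 0) ×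
          UnitaryGroup.arch (↥(maximalRealSubfield L)) L (IsCMField.complexConj L) 1 (Matrix.of fun i j : Fin 1 => if i.val + j.val + 1 = 1 then (1 : L) else 0))))]
    [∀ a : (UnitaryGroup.arch (↥(maximalRealSubfield L)) L (IsCMField.complexConj L) 2 (Matrix.of fun i j : Fin 2 => if i.val + j.val + 1 = 2 then (1 : L) else 0) ×
          UnitaryGroup.arch (↥(maximalRealSubfield L)) L (IsCMField.complexConj L) 1 (Matrix.of fun i j : Fin 1 => if i.val + j.val + 1 = 1 then (1 : L) else 0)),
      BorelSpace ((UnitaryGroup.arch (↥(maximalRealSubfield L)) L (IsCMField.complexConj L) 2 (Matrix.of fun i j : Fin 2 => if i.val + j.val + 1 = 2 then (1 : L) else 0) ×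
          UnitaryGroup.arch (↥(maximalRealSubfield L)) L (IsCMField.complexConj L) 1 (Matrix.of fun i j : Fin 1 => if i.val + j.val + 1 = 1 then (1 : L) else 0)) ⧸ Subgroup.centralizer ({a} : Set (UnitaryGroup.arch (↥(maximalRealSubfield L)) L (IsCMField.complexConj L) 2 (Matrix.of fun i j : Fin 2 => if i.val + j.val + 1 = 2 then (1 : L) else 0) ×
          UnitaryGroup.arch (↥(maximalRealSubfield L)) L (IsCMField.complexConj L) 1 (Matrix.of fun i j : Fin 1 => if i.val + j.val + 1 = 1 then (1 : L) else 0))))]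
    (νH : ∀ v : HeightOneSpectrum (𝓞 ↥(maximalRealSubfield L)), Measure ((UnitaryGroup.cmDatum L 2 (Matrix.of fun i j : Fin 2 => if i.val + j.val + 1 = 2 then (1 : L) else 0)).Local v ×
        (UnitaryGroup.cmDatum L 1 (Matrix.of fun i j : Fin 1 => if i.val + j.val + 1 = 1 then (1 : L) else 0)).Local v))
    (νG : ∀ v : HeightOneSpectrum (𝓞 ↥(maximalRealSubfield L)), Measure ((UnitaryGroup.cmDatum L 3 H').Local v))
    [∀ v, IsFiniteMeasureOnCompacts (νH v)] [∀ v, (νH v).IsMulRightInvariant]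
    [∀ v, (νG v).IsHaarMeasure] [∀ v, (νG v).IsMulRightInvariant]  -- MAIN-b's strength (F2): `νG_v` Haar
    (νGi : Measure (UnitaryGroup.arch (↥(maximalRealSubfield L)) L (IsCMField.complexConj L) 3 H')) (νqi : Measure (UnitaryGroup.arch (↥(maximalRealSubfield L)) L (IsCMField.complexConj L) 3 (Matrix.of fun i j : Fin 3 => if i.val + j.val + 1 = 3 then (1 : L) else 0)))
    (νHi : Measure (UnitaryGroup.arch (↥(maximalRealSubfield L)) L (IsCMField.complexConj L) 2 (Matrix.of fun i j : Fin 2 => if i.val + j.val + 1 = 2 then (1 : L) else 0) ×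
          UnitaryGroup.arch (↥(maximalRealSubfield L)) L (IsCMField.complexConj L) 1 (Matrix.of fun i j : Fin 1 => if i.val + j.val + 1 = 1 then (1 : L) else 0)))
    [IsFiniteMeasureOnCompacts νGi] [νGi.IsMulRightInvariant] [IsFiniteMeasureOnCompacts νqi] [νqi.IsMulRightInvariant]
    [IsFiniteMeasureOnCompacts νHi] [νHi.IsMulRightInvariant]

-- frame binders carried (socket bytes), several unread
set_option linter.unusedSectionVars false in
/-- **ASSEMBLY `‹(GS+RK2)_v′› → ‹sig_K2E4WeakMatrixFiniteTransportSplit›`** — socket #22S's statement VERBATIM from the joint frame-light letter «central germ structure + rank two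
among explicit transfer pairs at a split place» (prefix = (LIFT_v) cand :83 with `[νHv.IsHaarMeasure]`; clauses = (GS_v′) ∧ ★ p855314's `hRK`), instantiated at the letters' local
data `(νH v, νG v, Δ v, mH v, mG v)` of `hCTM` at a split `v` and fed, with ★ `isLocalDeltaTransferExists_finExplicit_of_split` and ★ p855355's one-class bookkeeping, to ★ p855314
`weakMatrixFiniteTransport_of_germStructure`.
[cite: Rogawski1990, §8.2 Prop. 8.2.1 (a) p. 117; §4.9 Prop. 4.9.1 (a) p. 55; §4.13 Lemma 4.13.1 (a) p. 64; §14.2 p. 232] [cite: HarishChandra1999AdmissibleDistributions, Thm. 3.1] -/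
theorem weakMatrixFiniteTransportSplit_of_rankTwoR
    (hGSRK :
        ∀ (L : Type) [Field L] [NumberField L] [IsCMField L] (H' : Matrix (Fin 3) (Fin 3) L),
          (H'.map (cmConjRingHom L)).transpose = H' →
          (∀ x : Fin 3 → L, hermForm (cmConjRingHom L) H' x x = 0 → x = 0) →
        ∀ (v : HeightOneSpectrum (𝓞 ↥(maximalRealSubfield L))), ¬ Subsingleton (UnitaryGroup.PlacesOver L v) →
        ∀
          [MeasurableSpace ((UnitaryGroup.cmDatum L 2 (Matrix.of fun i j : Fin 2 => if i.val + j.val + 1 = 2 then (1 : L) else 0)).Local v × (UnitaryGroup.cmDatum L 1 (Matrix.of fun i j : Fin 1 => if i.val + j.val + 1 = 1 then (1 : L) else 0)).Local v)] [BorelSpace ((UnitaryGroup.cmDatum L 2 (Matrix.of fun i j : Fin 2 => if i.val + j.val + 1 = 2 then (1 : L) else 0)).Local v × (UnitaryGroup.cmDatum L 1 (Matrix.of fun i j : Fin 1 => if i.val + j.val + 1 = 1 then (1 : L) else 0)).Local v)]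
          [∀ a : ((UnitaryGroup.cmDatum L 2 (Matrix.of fun i j : Fin 2 => if i.val + j.val + 1 = 2 then (1 : L) else 0)).Local v × (UnitaryGroup.cmDatum L 1 (Matrix.of fun i j : Fin 1 => if i.val + j.val + 1 = 1 then (1 : L) else 0)).Local v),
            MeasurableSpace (((UnitaryGroup.cmDatum L 2 (Matrix.of fun i j : Fin 2 => if i.val + j.val + 1 = 2 then (1 : L) else 0)).Local v × (UnitaryGroup.cmDatum L 1 (Matrix.of fun i j : Fin 1 => if i.val + j.val + 1 = 1 then (1 : L) else 0)).Local v) ⧸ Subgroup.centralizer ({a} : Set ((UnitaryGroup.cmDatum L 2 (Matrix.of fun i j : Fin 2 => if i.val + j.val + 1 = 2 then (1 : L) else 0)).Local v × (UnitaryGroup.cmDatum L 1 (Matrix.of fun i j : Fin 1 => if i.val + j.val + 1 = 1 then (1 : L) else 0)).Local v)))]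
          [∀ a : ((UnitaryGroup.cmDatum L 2 (Matrix.of fun i j : Fin 2 => if i.val + j.val + 1 = 2 then (1 : L) else 0)).Local v × (UnitaryGroup.cmDatum L 1 (Matrix.of fun i j : Fin 1 => if i.val + j.val + 1 = 1 then (1 : L) else 0)).Local v),
            BorelSpace (((UnitaryGroup.cmDatum L 2 (Matrix.of fun i j : Fin 2 => if i.val + j.val + 1 = 2 then (1 : L) else 0)).Local v × (UnitaryGroup.cmDatum L 1 (Matrix.of fun i j : Fin 1 => if i.val + j.val + 1 = 1 then (1 : L) else 0)).Local v) ⧸ Subgroup.centralizer ({a} : Set ((UnitaryGroup.cmDatum L 2 (Matrix.of fun i j : Fin 2 => if i.val + j.val + 1 = 2 then (1 : L) else 0)).Local v × (UnitaryGroup.cmDatum L 1 (Matrix.of fun i j : Fin 1 => if i.val + j.val + 1 = 1 then (1 : L) else 0)).Local v)))]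
          [MeasurableSpace ((UnitaryGroup.cmDatum L 3 H').Local v)] [BorelSpace ((UnitaryGroup.cmDatum L 3 H').Local v)]
          [∀ γ : ((UnitaryGroup.cmDatum L 3 H').Local v), MeasurableSpace (((UnitaryGroup.cmDatum L 3 H').Local v) ⧸ Subgroup.centralizer ({γ} : Set ((UnitaryGroup.cmDatum L 3 H').Local v)))]
          [∀ γ : ((UnitaryGroup.cmDatum L 3 H').Local v), BorelSpace (((UnitaryGroup.cmDatum L 3 H').Local v) ⧸ Subgroup.centralizer ({γ} : Set ((UnitaryGroup.cmDatum L 3 H').Local v)))]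
          (νHv : Measure ((UnitaryGroup.cmDatum L 2 (Matrix.of fun i j : Fin 2 => if i.val + j.val + 1 = 2 then (1 : L) else 0)).Local v × (UnitaryGroup.cmDatum L 1 (Matrix.of fun i j : Fin 1 => if i.val + j.val + 1 = 1 then (1 : L) else 0)).Local v)) (νGv : Measure ((UnitaryGroup.cmDatum L 3 H').Local v))
          [νHv.IsHaarMeasure] [νHv.IsMulRightInvariant] [νGv.IsHaarMeasure] [νGv.IsMulRightInvariant]
          (mHv : OrbitalMeasureFamily ((UnitaryGroup.cmDatum L 2 (Matrix.of fun i j : Fin 2 => if i.val + j.val + 1 = 2 then (1 : L) else 0)).Local v × (UnitaryGroup.cmDatum L 1 (Matrix.of fun i j : Fin 1 => if i.val + j.val + 1 = 1 then (1 : L) else 0)).Local v)) (mGv : OrbitalMeasureFamily ((UnitaryGroup.cmDatum L 3 H').Local v)),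
          mHv.IsCanonical (IsLocalGRegular L v) νHv →
          mGv.IsCanonical (fun γ : ((UnitaryGroup.cmDatum L 3 H').Local v) => IsRegularElt (γ.val : GL (Fin 3) (UnitaryGroup.LocalRing L v))) νGv →
        ∀ (μ : HeckeCharacter L), μ.IsUnitary →
          (∀ x : ideleGroup ↥(maximalRealSubfield L), μ (AdeleRing.ideleBaseChange (↥(maximalRealSubfield L)) L x) = quadraticHeckeCharCM L x) →
        ∀ (γH : (UnitaryGroup.cmDatum L 2 (Matrix.of fun i j : Fin 2 => if i.val + j.val + 1 = 2 then (1 : L) else 0)).Rational × (UnitaryGroup.cmDatum L 1 (Matrix.of fun i j : Fin 1 => if i.val + j.val + 1 = 1 then (1 : L) else 0)).Rational) (e₁ e₂ : L), e₁ ≠ e₂ →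
          (((γH.1 : unitaryGroup (cmConjRingHom L) (Matrix.of fun i j : Fin 2 => if i.val + j.val + 1 = 2 then (1 : L) else 0)).val : GL (Fin 2) L) : Matrix (Fin 2) (Fin 2) L) = e₁ • (1 : Matrix (Fin 2) (Fin 2) L) →
          (((γH.2 : unitaryGroup (cmConjRingHom L) (Matrix.of fun i j : Fin 1 => if i.val + j.val + 1 = 1 then (1 : L) else 0)).val : GL (Fin 1) L) : Matrix (Fin 1) (Fin 1) L) 0 0 = e₂ →
        ∃ (γ : ℕ → ((UnitaryGroup.cmDatum L 2 (Matrix.of fun i j : Fin 2 => if i.val + j.val + 1 = 2 then (1 : L) else 0)).Local v × (UnitaryGroup.cmDatum L 1 (Matrix.of fun i j : Fin 1 => if i.val + j.val + 1 = 1 then (1 : L) else 0)).Local v)) (G : ℕ → ℂ) (lam lam' : ℂ),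
          (∀ n, IsLocalGRegular L v (γ n)) ∧
          Tendsto γ atTop (nhds
            ((UnitaryGroup.cmDatum L 2 (Matrix.of fun i j : Fin 2 => if i.val + j.val + 1 = 2 then (1 : L) else 0)).toLocal v ((UnitaryGroup.cmDatum L 2 (Matrix.of fun i j : Fin 2 => if i.val + j.val + 1 = 2 then (1 : L) else 0)).toAdelic γH.1),
              (UnitaryGroup.cmDatum L 1 (Matrix.of fun i j : Fin 1 => if i.val + j.val + 1 = 1 then (1 : L) else 0)).toLocal v ((UnitaryGroup.cmDatum L 1 (Matrix.of fun i j : Fin 1 => if i.val + j.val + 1 = 1 then (1 : L) else 0)).toAdelic γH.2))) ∧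
          (Set.range G).Infinite ∧ lam ≠ 0 ∧
          (∀ φ : ((UnitaryGroup.cmDatum L 2 (Matrix.of fun i j : Fin 2 => if i.val + j.val + 1 = 2 then (1 : L) else 0)).Local v × (UnitaryGroup.cmDatum L 1 (Matrix.of fun i j : Fin 1 => if i.val + j.val + 1 = 1 then (1 : L) else 0)).Local v) → ℂ, IsLocSmooth φ →
            ∃ a b : ℂ, (∀ᶠ n in atTop, stableOrbitalIntegralRel (IsLocalStablyConjH L v) mHv φ (γ n) = a + b * G n) ∧
              φ ((UnitaryGroup.cmDatum L 2 (Matrix.of fun i j : Fin 2 => if i.val + j.val + 1 = 2 then (1 : L) else 0)).toLocal v ((UnitaryGroup.cmDatum L 2 (Matrix.of fun i j : Fin 2 => if i.val + j.val + 1 = 2 then (1 : L) else 0)).toAdelic γH.1),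
              (UnitaryGroup.cmDatum L 1 (Matrix.of fun i j : Fin 1 => if i.val + j.val + 1 = 1 then (1 : L) else 0)).toLocal v ((UnitaryGroup.cmDatum L 1 (Matrix.of fun i j : Fin 1 => if i.val + j.val + 1 = 1 then (1 : L) else 0)).toAdelic γH.2)) = lam * a + lam' * b) ∧
          (∃ (φ₁ φ₂ : ((UnitaryGroup.cmDatum L 2 (Matrix.of fun i j : Fin 2 => if i.val + j.val + 1 = 2 then (1 : L) else 0)).Local v × (UnitaryGroup.cmDatum L 1 (Matrix.of fun i j : Fin 1 => if i.val + j.val + 1 = 1 then (1 : L) else 0)).Local v) → ℂ) (a₁ b₁ a₂ b₂ : ℂ), IsLocSmooth φ₁ ∧ IsLocSmooth φ₂ ∧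
            (∀ᶠ n in atTop, stableOrbitalIntegralRel (IsLocalStablyConjH L v) mHv φ₁ (γ n) = a₁ + b₁ * G n) ∧
            (∀ᶠ n in atTop, stableOrbitalIntegralRel (IsLocalStablyConjH L v) mHv φ₂ (γ n) = a₂ + b₂ * G n) ∧ a₁ * b₂ - a₂ * b₁ ≠ 0) ∧
          (∃ (f₁ f₂ : (UnitaryGroup.cmDatum L 3 H').Local v → ℂ) (fH'₁ fH'₂ : ((UnitaryGroup.cmDatum L 2 (Matrix.of fun i j : Fin 2 => if i.val + j.val + 1 = 2 then (1 : L) else 0)).Local v ×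
              (UnitaryGroup.cmDatum L 1 (Matrix.of fun i j : Fin 1 => if i.val + j.val + 1 = 1 then (1 : L) else 0)).Local v) → ℂ) (a'₁ b'₁ a'₂ b'₂ : ℂ),
            IsLocSmooth f₁ ∧ IsLocSmooth f₂ ∧ IsLocSmooth fH'₁ ∧ IsLocSmooth fH'₂ ∧
            IsLocalDeltaTransfer L H' v (finExplicitCollection L H' μ (finExplicitDelta_conj_left_all L H' μ) (finExplicitDelta_conj_right_all L H' μ) v) mHv mGv fH'₁ f₁ ∧
            IsLocalDeltaTransfer L H' v (finExplicitCollection L H' μ (finExplicitDelta_conj_left_all L H' μ) (finExplicitDelta_conj_right_all L H' μ) v) mHv mGv fH'₂ f₂ ∧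
            (∀ᶠ n in atTop, stableOrbitalIntegralRel (IsLocalStablyConjH L v) mHv fH'₁ (γ n) = a'₁ + b'₁ * G n) ∧
            (∀ᶠ n in atTop, stableOrbitalIntegralRel (IsLocalStablyConjH L v) mHv fH'₂ (γ n) = a'₂ + b'₂ * G n) ∧ a'₁ * b'₂ - a'₂ * b'₁ ≠ 0)) :
        ∀ (hK : ∀ v : HeightOneSpectrum (𝓞 ↥(maximalRealSubfield L)), νG v (UnitaryGroup.cmLocalIntegralLevel L 3 H' v : Set ((UnitaryGroup.cmDatum L 3 H').Local v)) = 1)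
          (hanis : ∀ x : Fin 3 → L, hermForm (cmConjRingHom L) H' x x = 0 → x = 0)
          (Sbad : Finset (HeightOneSpectrum (𝓞 ↥(maximalRealSubfield L))))
              (Δ : ∀ v : HeightOneSpectrum (𝓞 ↥(maximalRealSubfield L)), LocalTransferFactor L H' v)
              (mH : ∀ v : HeightOneSpectrum (𝓞 ↥(maximalRealSubfield L)),
                OrbitalMeasureFamily ((UnitaryGroup.cmDatum L 2 (Matrix.of fun i j : Fin 2 => if i.val + j.val + 1 = 2 then (1 : L) else 0)).Local v ×
                  (UnitaryGroup.cmDatum L 1 (Matrix.of fun i j : Fin 1 => if i.val + j.val + 1 = 1 then (1 : L) else 0)).Local v))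
              (mG : ∀ v : HeightOneSpectrum (𝓞 ↥(maximalRealSubfield L)), OrbitalMeasureFamily ((UnitaryGroup.cmDatum L 3 H').Local v))
          (m' : OrbitalMeasureFamily (UnitaryGroup.arch (↥(maximalRealSubfield L)) L (IsCMField.complexConj L) 3 H'))
                (m : OrbitalMeasureFamily (UnitaryGroup.arch (↥(maximalRealSubfield L)) L (IsCMField.complexConj L) 3
                  (Matrix.of fun i j : Fin 3 => if i.val + j.val + 1 = 3 then (1 : L) else 0)))
                (mHi : OrbitalMeasureFamily (UnitaryGroup.arch (↥(maximalRealSubfield L)) L (IsCMField.complexConj L) 2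
                    (Matrix.of fun i j : Fin 2 => if i.val + j.val + 1 = 2 then (1 : L) else 0) ×
                  UnitaryGroup.arch (↥(maximalRealSubfield L)) L (IsCMField.complexConj L) 1
                    (Matrix.of fun i j : Fin 1 => if i.val + j.val + 1 = 1 then (1 : L) else 0)))
                (t' : ∀ γ' : UnitaryGroup.arch (↥(maximalRealSubfield L)) L (IsCMField.complexConj L) 3 H',
                  Measure (Subgroup.centralizer ({γ'} : Set (UnitaryGroup.arch (↥(maximalRealSubfield L)) L (IsCMField.complexConj L) 3 H'))))
                (t : ∀ γ : UnitaryGroup.arch (↥(maximalRealSubfield L)) L (IsCMField.complexConj L) 3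
                    (Matrix.of fun i j : Fin 3 => if i.val + j.val + 1 = 3 then (1 : L) else 0),
                  Measure (Subgroup.centralizer ({γ} : Set (UnitaryGroup.arch (↥(maximalRealSubfield L)) L (IsCMField.complexConj L) 3
                    (Matrix.of fun i j : Fin 3 => if i.val + j.val + 1 = 3 then (1 : L) else 0)))))
                (tH : ∀ γH : UnitaryGroup.arch (↥(maximalRealSubfield L)) L (IsCMField.complexConj L) 2
                      (Matrix.of fun i j : Fin 2 => if i.val + j.val + 1 = 2 then (1 : L) else 0) ×
                    UnitaryGroup.arch (↥(maximalRealSubfield L)) L (IsCMField.complexConj L) 1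
                      (Matrix.of fun i j : Fin 1 => if i.val + j.val + 1 = 1 then (1 : L) else 0),
                  Measure (Subgroup.centralizer ({γH} : Set (UnitaryGroup.arch (↥(maximalRealSubfield L)) L (IsCMField.complexConj L) 2
                      (Matrix.of fun i j : Fin 2 => if i.val + j.val + 1 = 2 then (1 : L) else 0) ×
                    UnitaryGroup.arch (↥(maximalRealSubfield L)) L (IsCMField.complexConj L) 1
                      (Matrix.of fun i j : Fin 1 => if i.val + j.val + 1 = 1 then (1 : L) else 0)))))
            (hherm : (H'.map (cmConjRingHom L)).transpose = H')
            (hCTM : CanonicalTransferMatrix L H' Tinf.Δ νH νG Sbad Δ mH mG)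
            (hACS : ArchCanonicalSingularMatrix L H' Tinf νGi νqi νHi hanis m' m mHi t' t tH),
    ∀ (μ : Literature.NumberTheory.GaloisRepresentations.HeckeCharacter L) (hμu : μ.IsUnitary)
      (hμω : ∀ x : Literature.NumberTheory.GaloisRepresentations.ideleGroup ↥(maximalRealSubfield L),
        μ (AdeleRing.ideleBaseChange (↥(maximalRealSubfield L)) L x) = quadraticHeckeCharCM L x),
        ∀ (mGs₀ : ∀ v : HeightOneSpectrum (𝓞 ↥(maximalRealSubfield L)), OrbitalMeasureFamily ((UnitaryGroup.cmDatum L 3 H').Local v)),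
          (∀ v, (mGs₀ v).IsQuotientOf (fun x : (UnitaryGroup.cmDatum L 3 H').Local v => ∃ γ₀ : (UnitaryGroup.cmDatum L 3 H').Rational, ¬ IsRegularElt (γ₀.val : GL (Fin 3) L) ∧
                Corresponds (UnitaryGroup.conjLocal L (IsCMField.complexConj L) v)
                  ((UnitaryGroup.adelicForm L 3 H').map (UnitaryGroup.adeleToLocal L v))
                  ((UnitaryGroup.adelicForm L 3 H').map (UnitaryGroup.adeleToLocal L v))
                  ((UnitaryGroup.cmDatum L 3 H').toLocal v ((UnitaryGroup.cmDatum L 3 H').toAdelic γ₀)) x) (νG v) (Literature.NumberTheory.Weil1982.UnitaryFinTopForm.finTamagawaPartner L 3 H' v)) →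
              ∀ (γ₀ : (UnitaryGroup.cmDatum L 3 H').Rational) (e₁ e₂ : L), e₁ ≠ e₂ →
                ((((γ₀ : unitaryGroup (cmConjRingHom L) H').val : GL (Fin 3) L) : Matrix (Fin 3) (Fin 3) L) - e₁ • (1 : Matrix (Fin 3) (Fin 3) L)) * ((((γ₀ : unitaryGroup (cmConjRingHom L) H').val : GL (Fin 3) L) : Matrix (Fin 3) (Fin 3) L) - e₂ • (1 : Matrix (Fin 3) (Fin 3) L)) = 0 →
                (¬ ∃ ζ : L, (((γ₀ : unitaryGroup (cmConjRingHom L) H').val : GL (Fin 3) L) : Matrix (Fin 3) (Fin 3) L) = ζ • (1 : Matrix (Fin 3) (Fin 3) L)) →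
                (((γ₀ : unitaryGroup (cmConjRingHom L) H').val : GL (Fin 3) L) : Matrix (Fin 3) (Fin 3) L).charpoly =
                  (Polynomial.X - Polynomial.C e₁) ^ 2 * (Polynomial.X - Polynomial.C e₂) →
                ∀ (γH : (UnitaryGroup.cmDatum L 2 (Matrix.of fun i j : Fin 2 => if i.val + j.val + 1 = 2 then (1 : L) else 0)).Rational ×
                    (UnitaryGroup.cmDatum L 1 (Matrix.of fun i j : Fin 1 => if i.val + j.val + 1 = 1 then (1 : L) else 0)).Rational),
                  (((γH.1 : unitaryGroup (cmConjRingHom L) (Matrix.of fun i j : Fin 2 => if i.val + j.val + 1 = 2 then (1 : L) else 0)).val : GL (Fin 2) L) : Matrix (Fin 2) (Fin 2) L) =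
                    e₁ • (1 : Matrix (Fin 2) (Fin 2) L) →
                  (((γH.2 : unitaryGroup (cmConjRingHom L) (Matrix.of fun i j : Fin 1 => if i.val + j.val + 1 = 1 then (1 : L) else 0)).val : GL (Fin 1) L) : Matrix (Fin 1) (Fin 1) L) 0 0 = e₂ →
                  ∀ (v : HeightOneSpectrum (𝓞 ↥(maximalRealSubfield L))), ¬ Subsingleton (UnitaryGroup.PlacesOver L v) →
                    (∃ cv : ℂ, cv ≠ 0 ∧ ∀
                          (fH : (UnitaryGroup.cmDatum L 2 (Matrix.of fun i j : Fin 2 => if i.val + j.val + 1 = 2 then (1 : L) else 0)).Local v × (UnitaryGroup.cmDatum L 1 (Matrix.of fun i j : Fin 1 => if i.val + j.val + 1 = 1 then (1 : L) else 0)).Local v → ℂ) (f : (UnitaryGroup.cmDatum L 3 H').Local v → ℂ),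
                        IsLocSmooth f → IsLocSmooth fH → IsLocalDeltaTransfer L H' v (finExplicitCollection L H' μ (finExplicitDelta_conj_left_all L H' μ) (finExplicitDelta_conj_right_all L H' μ) v) (mH v) (mG v) fH f →
                        localStableOrbitalIntegral L 3 H' v (mGs₀ v) f ((UnitaryGroup.cmDatum L 3 H').toLocal v ((UnitaryGroup.cmDatum L 3 H').toAdelic γ₀)) =
                          cv * fH ((UnitaryGroup.cmDatum L 2 (Matrix.of fun i j : Fin 2 => if i.val + j.val + 1 = 2 then (1 : L) else 0)).toLocal v ((UnitaryGroup.cmDatum L 2 (Matrix.of fun i j : Fin 2 => if i.val + j.val + 1 = 2 then (1 : L) else 0)).toAdelic γH.1),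
                            (UnitaryGroup.cmDatum L 1 (Matrix.of fun i j : Fin 1 => if i.val + j.val + 1 = 1 then (1 : L) else 0)).toLocal v ((UnitaryGroup.cmDatum L 1 (Matrix.of fun i j : Fin 1 => if i.val + j.val + 1 = 1 then (1 : L) else 0)).toAdelic γH.2))) →
                    ∃ cv : ℂ, cv ≠ 0 ∧ ∀
                          (fH : (UnitaryGroup.cmDatum L 2 (Matrix.of fun i j : Fin 2 => if i.val + j.val + 1 = 2 then (1 : L) else 0)).Local v × (UnitaryGroup.cmDatum L 1 (Matrix.of fun i j : Fin 1 => if i.val + j.val + 1 = 1 then (1 : L) else 0)).Local v → ℂ) (f : (UnitaryGroup.cmDatum L 3 H').Local v → ℂ),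
                        IsLocSmooth f → IsLocSmooth fH → IsLocalDeltaTransfer L H' v (Δ v) (mH v) (mG v) fH f →
                        localStableOrbitalIntegral L 3 H' v (mGs₀ v) f ((UnitaryGroup.cmDatum L 3 H').toLocal v ((UnitaryGroup.cmDatum L 3 H').toAdelic γ₀)) =
                          cv * fH ((UnitaryGroup.cmDatum L 2 (Matrix.of fun i j : Fin 2 => if i.val + j.val + 1 = 2 then (1 : L) else 0)).toLocal v ((UnitaryGroup.cmDatum L 2 (Matrix.of fun i j : Fin 2 => if i.val + j.val + 1 = 2 then (1 : L) else 0)).toAdelic γH.1),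
                            (UnitaryGroup.cmDatum L 1 (Matrix.of fun i j : Fin 1 => if i.val + j.val + 1 = 1 then (1 : L) else 0)).toLocal v ((UnitaryGroup.cmDatum L 1 (Matrix.of fun i j : Fin 1 => if i.val + j.val + 1 = 1 then (1 : L) else 0)).toAdelic γH.2)) := by
  intro hK hanis Sbad Δ mH mG m' m mHi t' t tH hherm hCTM hACS μ hμu hμω mGs₀ hquot γ₀ e₁ e₂ hne hprod hnsc hchar γH hγH1 hγH2 v hns
  classical
  -- (1) a split witness `w ∣ v`, `c • w ≠ w`
  obtain ⟨w, hw⟩ : ∃ w : UnitaryGroup.PlacesOver L v, IsCMField.complexConj L • w.1 ≠ w.1 := by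
    by_contra h
    obtain ⟨w⟩ := UnitaryGroup.PlacesOver.nonempty L v
    exact hns (UnitaryGroup.PlacesOver.subsingleton_of_smul_eq (IsCMField.complexConj L) (IsCMField.complexConj_ne_one L) w
      (not_not.1 fun hw => h ⟨w, hw⟩))
  -- (2) `νH v` is a Haar measure: unimodularity of `H_v` + `νH v ≠ 0` (admissibility of the canonical member at a `G`-regular class) — ★ p854983's idiom
  have hne0 : νH v ≠ 0 := by
    intro hv0
    obtain ⟨γH', -, hreg', -⟩ := K2E4WeakMatrixAlmostEverywhereAgreement.exists_isGRegular_isNormPair (L := L) H' hherm hanis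
    have hP := isLocalGRegular_out_mk_rationalComponent L γH' hreg' v
    obtain ⟨t₀, ht₀, hti, -, hm⟩ := (hCTM.1 v).2.2.1 _ hP
    have hz := ((hCTM.1 v).1.2.1 _ hP).1
    rw [hm] at hz
    exact hz (quotientMeasure_eq_zero_of_eq_zero _ _ t₀ (νH v) hv0)
  haveI : (νH v).IsHaarMeasure := by
    haveI := K2E4WeakMatrixAlmostEverywhereAgreement.isMulRightInvariant_endoscopicLocal L v (MeasureTheory.Measure.haar : Measure ((UnitaryGroup.cmDatum L 2 (Matrix.of fun i j : Fin 2 => if i.val + j.val + 1 = 2 then (1 : L) else 0)).Local v × (UnitaryGroup.cmDatum L 1 (Matrix.of fun i j : Fin 1 => if i.val + j.val + 1 = 1 then (1 : L) else 0)).Local v))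
    exact isHaarMeasure_of_isMulRightInvariant_of_ne_zero MeasureTheory.Measure.haar (νH v) hne0
  -- (3) `Δ‴_v`-transfer existence for the canonical families at the split place (N6 split clause)
  have hH'd : IsUnit H'.det := isUnit_iff_ne_zero.mpr (Godement.det_ne_zero_of_anisotropic L H' hanis)
  have hH'c : (H'.map (IsCMField.complexConj L))ᵀ = H' := (UnitaryGroup.map_cmConjRingHom_eq_map_complexConj L H') ▸ hherm
  letI : MeasurableSpace (w.1.adicCompletion L) := borel _
  haveI : BorelSpace (w.1.adicCompletion L) := ⟨rfl⟩
  have hΦ₂d : (Matrix.of fun i j : Fin 2 => if i.val + j.val + 1 = 2 then (1 : L) else 0).det ≠ 0 := (UnitaryGroup.isUnit_antidiagOne_det L 2).ne_zero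
  have hΦ₁d : (Matrix.of fun i j : Fin 1 => if i.val + j.val + 1 = 1 then (1 : L) else 0).det ≠ 0 := (UnitaryGroup.isUnit_antidiagOne_det L 1).ne_zero
  have hTexp := isLocalDeltaTransferExists_finExplicit_of_split L H' (IsCMField.complexConj_ne_one L) w hw
    (UnitaryGroup.antidiagOne_map_transpose (IsCMField.complexConj L) 2) (UnitaryGroup.isUnit_placeForm_antidiagOne (E := L) 2 w.1)
    (UnitaryGroup.antidiagOne_map_transpose (IsCMField.complexConj L) 1) (UnitaryGroup.isUnit_placeForm_antidiagOne (E := L) 1 w.1)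
    hH'c (UnitaryGroup.isUnit_placeForm_of_isUnit_det hH'd w.1)
    (UnitaryGroup.antidiagOne_isHermitian L 2) hΦ₂d (UnitaryGroup.antidiagOne_isHermitian L 1) hΦ₁d
    μ (finExplicitDelta_conj_left_all L H' μ) (finExplicitDelta_conj_right_all L H' μ)
    (HeckeCharacter.galConj_eq_inv_of_restrict_eq_quadraticHeckeCharCM L μ hμω) (νH v) (νG v) (mH v) (mG v) (hCTM.1 v).2.2.1 (hCTM.1 v).2.2.2
  -- (4) the joint letter at `v`, for the frame's data
  obtain ⟨γ, G, lam, lam', hreg, -, hG, -, hGS1, -, hRK⟩ :=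
    hGSRK L H' hherm hanis v hns (νH v) (νG v) (mH v) (mG v) (hCTM.1 v).2.2.1 (hCTM.1 v).2.2.2 μ hμu hμω γH e₁ e₂ hne hγH1 hγH2
  -- (5) ONE matching class along the ray (split place) and non-vanishing of both factors there (★ p855355's bookkeeping)
  have hmatch : ∀ n, ∃ g : (UnitaryGroup.cmDatum L 3 H').Local v, IsLocalNormPair L H' v (γ n) g := fun n => by
    obtain ⟨g, hg, -⟩ := exists_isLocalNormPair_of_split L H' (IsCMField.complexConj_ne_one L) w hw
      (UnitaryGroup.antidiagOne_map_transpose (IsCMField.complexConj L) 2) (UnitaryGroup.isUnit_placeForm_antidiagOne (E := L) 2 w.1)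
      (UnitaryGroup.antidiagOne_map_transpose (IsCMField.complexConj L) 1) (UnitaryGroup.isUnit_placeForm_antidiagOne (E := L) 1 w.1)
      hH'c (UnitaryGroup.isUnit_placeForm_of_isUnit_det hH'd w.1) (γ n)
    exact ⟨g, hg⟩
  choose γG hγG using hmatch
  -- (6) ★ p855314: Möbius central-value rigidity from (GS) + rank two among explicit pairs
  exact weakMatrixFiniteTransport_of_germStructure L H' v (Δ v) μ (mH v) (mG v) (mGs₀ v) (hCTM.1 v).1.2.2.2 hTexp γ₀ γH γ hreg
    (fun n => ConjClasses.mk (γG n))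
    (fun n c hc' => delta_eq_zero_of_ne_mk_of_split L H' v hH'c w hw (UnitaryGroup.isUnit_placeForm_of_isUnit_det hH'd w.1) (Δ v) (hγG n) c hc')
    (fun n c hc' => delta_eq_zero_of_ne_mk_of_split L H' v hH'c w hw (UnitaryGroup.isUnit_placeForm_of_isUnit_det hH'd w.1) _ (hγG n) c hc')
    (fun n => (hCTM.1 v).1.1 _ _ (isLocalNormPair_out_mk L H' v (hγG n)) (hreg n))
    (fun n => isLocalNondegenerate_finExplicitCollection L H' μ (finExplicitDelta_conj_left_all L H' μ)
      (finExplicitDelta_conj_right_all L H' μ) v _ _ (isLocalNormPair_out_mk L H' v (hγG n)) (hreg n))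
    G hG lam lam' hGS1 hRK

end Frame

end Summit.HodgeConjecture.HodgeConjecture.Cruxes.H413.K2E4WeakMatrixFiniteTransportSplitOfRankTwoR

end
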